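import Summits.QuantumFields.BalabanUV.T4Continuum.Support.NE7LandauNewtonScheme
import HarnessLib

/-!
# NE7LandauNewtonLimit — THE EXACTLY GAUGED REPRESENTATIVE AT THE TOP (brick T4c of ROAD v4): the Newton sequence of `NE7LandauNewtonScheme` converges; its limit `u`
# is a unitary periodic gauge with `‖u − 1‖ ≤ 4c_t m₀`, the links of `V^{u}` within `c_r m₀∕n₀` of `1`, and `Z := log V^{u}` EXACTLY in Bałaban's linear Landau gauge
# `(1 − P)∂* z_{ii′} = 0` on lit-balaban's torus (every entry), with `‖Z‖ ≤ 2(K+K′)m₀∕n₀` and straight averages `|Q_k z_{ii′}| ≤ 2m₀∕n₀` — all k- and N-uniform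
# (`NE7LandauNewtonLimit`)

Cell `pub-balaban`, lineage `t4-ne7-p1` (CRUX PROVER NE7 #1 = OWNER of row NE7), gen 74; memo `t4/b2b-balaban-t4-ne7-p1-g74/REP-FLAT-ROAD-v4.md` §2–§3.  Template: row NE3's
`Spine/NE3/FlatLandauRep` (pointwise Cauchy gauges, `isClosed_unitary`, `4∕3`-Lipschitz `log`).  WITH `m₀ = n₀·2a + n₀²(ε + 32(2a)²) + n₀q₀ = O(δ)` at the top of the v2
sup gauge (`NE7SliceInduction`: `a = Cδ∕M`, `ε = δ∕M²`, `q₀ = O(δ∕M)` by T1), the radius `c_r m₀∕n₀` is G7's `hr₀ = O(δ∕M)` and `Z` is the input of the gradient letter (T5: IS-grad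
`NE7LandauExactSup.exists_exact_grad_const` with the straight datum `2m₀∕n₀` and the current).
CONTENT ([folklore]; 0 def, 0 sorry; dimension `d + 1`).  `exists_top_landau_gauge`.
HONEST FRAMING (page 1): OUR construction at the FLAT background; nothing of [B8]'s curved statements is claimed; REP♭'s GRADIENT member is NOT here (T5); (APE) NOT proved;
NE7 NOT PRINTED ∕ NOT PROVED (0∕1); spine PROVED 0∕9; rung (B)+1 finite T⁴ — NOT infinite volume, NOT mass gap, NOT BetaPertH, NOT Clay.  PLACEMENT: our lemma, under
`Summits/QuantumFields/BalabanUV/`.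
Continuum YM on T⁴ ⇐ BetaPertH ∧ nine spine estimates (0/9 proved); BetaPertH ⇐ (D1) ∧ (D4) ∧ CAP+tail; G-an2-4 gates asym, D1 and NE2/3/4.
-/

set_option autoImplicit false

open scoped BigOperators Matrix Matrix.Norms.L2Operator Topology
open NormedSpace Finset Filter

namespace Summit.QuantumFields.BalabanUV.T4Continuum.NE7LandauNewtonLimit

open Literature.MathematicalPhysics.QuantumFieldTheory.Balaban1983to89
open B7Prop1Explicit B7Prop2Explicit MatrixLog
open T4AveragingDeficitWall (IsUnitaryCfg IsSkewDir SmallField)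
open T4AveragingDeficitWallBoundary (IsPeriodicCfg)
open NE3EnergyShapes (IsUnitarySite IsPeriodicSite)
open B5Prop11Plancherel (Tor fine)
open B5Action121 (GradOp)
open B5Block118 (QvOp)
open B5Value126 (PcT)
open B6LowerBound2153Torus (rep)
open NE7ExpLogSecondOrder (norm_mlog_sub_mlog_le_four_thirds)
open NE7LandauNewtonScheme (newton_sequence)

noncomputable section

variable {d : ℕ} {n : Type*} [Fintype n] [DecidableEq n]

/-- **THE EXACTLY GAUGED REPRESENTATIVE AT THE TOP** (dimension `d + 1`; hypotheses = those of `NE7LandauNewtonScheme.newton_sequence`): `∃ u` unitary `(n₀N)`-periodic with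
`‖u − 1‖ ≤ 4c_t m₀`, links of `V^{u}` within `c_r m₀∕n₀` of `1`, `Z = log V^{u}` EXACTLY `(1 − P)∂*`-gauged entry by entry on lit-balaban's torus, `‖Z‖ ≤ 2(K+K′)m₀∕n₀`,
`|Q_k z_{ii′}| ≤ 2m₀∕n₀`. [folklore] -/
theorem exists_top_landau_gauge [Nonempty n] :
    ∃ K K' : ℝ, 0 < K ∧ 0 < K' ∧ ∀ (n₀ N : ℕ) [NeZero n₀] [NeZero N]
      (V : Site (d + 1) → Fin (d + 1) → (Matrix n n ℂ)ˣ) (ε a q₀ m₀ ct cδ cr : ℝ),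
      IsUnitaryCfg V → IsPeriodicCfg V ((n₀ * N : ℕ) : ℤ) → 0 ≤ ε → SmallField V ε → 0 ≤ a →
      (∀ (y : Site (d + 1)) (κ : Fin (d + 1)), ‖((V y κ : (Matrix n n ℂ)ˣ) : Matrix n n ℂ) - 1‖ ≤ a) → 0 ≤ q₀ →
      (∀ (j j' : n) (t : Tor (fun _ : Fin (d + 1) => N)) (κ : Fin (d + 1)),
        ‖(QvOp n₀ (fun _ : Fin (d + 1) => N) *ᵥ fun p : Tor (fine n₀ (fun _ : Fin (d + 1) => N)) × Fin (d + 1) =>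
          mlog ((V (rep (fine n₀ (fun _ : Fin (d + 1) => N)) p.1) p.2 : (Matrix n n ℂ)ˣ) : Matrix n n ℂ) j j') (t, κ)‖ ≤ q₀) →
      m₀ = (n₀ : ℝ) * (2 * a) + (n₀ : ℝ) ^ 2 * (ε + 32 * (2 * a) ^ 2) + (n₀ : ℝ) * q₀ →
      ct = ((d + 1 : ℕ) : ℝ) * (Fintype.card n + K + K') → cδ = 1 + K + K' → cr = 4 * (K + K') + 1 + 8 * (ct + cδ) * cδ →
      (80 * cr + 40 * ct + 40 * cδ + 8 * (ct + cδ) * (2 * cr + cδ) + 2 * (4 * ct + 128 * cr * (cδ + 1 / 2))) * m₀ ≤ 1 →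
      ∃ u : Site (d + 1) → (Matrix n n ℂ)ˣ,
        IsUnitarySite u ∧ IsPeriodicSite u ((n₀ * N : ℕ) : ℤ) ∧
        (∀ y : Site (d + 1), ‖((u y : (Matrix n n ℂ)ˣ) : Matrix n n ℂ) - 1‖ ≤ 4 * ct * m₀) ∧
        (∀ (y : Site (d + 1)) (κ : Fin (d + 1)), ‖((gaugeAct u V y κ : (Matrix n n ℂ)ˣ) : Matrix n n ℂ) - 1‖ ≤ cr * (m₀ / n₀)) ∧
        (∀ j j' : n, (1 - PcT n₀ (fun _ : Fin (d + 1) => N) (n₀ : ℂ)) *ᵥ ((GradOp (fine n₀ (fun _ : Fin (d + 1) => N)) (n₀ : ℂ))ᴴ *ᵥ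
          fun p : Tor (fine n₀ (fun _ : Fin (d + 1) => N)) × Fin (d + 1) =>
            mlog ((gaugeAct u V (rep (fine n₀ (fun _ : Fin (d + 1) => N)) p.1) p.2 : (Matrix n n ℂ)ˣ) : Matrix n n ℂ) j j') = 0) ∧
        (∀ (y : Site (d + 1)) (κ : Fin (d + 1)), ‖mlog ((gaugeAct u V y κ : (Matrix n n ℂ)ˣ) : Matrix n n ℂ)‖ ≤ 2 * (K + K') * (m₀ / n₀)) ∧
        (∀ (j j' : n) (t : Tor (fun _ : Fin (d + 1) => N)) (κ : Fin (d + 1)),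
          ‖(QvOp n₀ (fun _ : Fin (d + 1) => N) *ᵥ fun p : Tor (fine n₀ (fun _ : Fin (d + 1) => N)) × Fin (d + 1) =>
            mlog ((gaugeAct u V (rep (fine n₀ (fun _ : Fin (d + 1) => N)) p.1) p.2 : (Matrix n n ℂ)ˣ) : Matrix n n ℂ) j j') (t, κ)‖ ≤ 2 * (m₀ / n₀)) := by
  letI : CStarAlgebra (Matrix n n ℂ) := {}
  obtain ⟨K, K', hK, hK', hseqall⟩ := newton_sequence (d := d) (n := n)
  refine ⟨K, K', hK, hK', ?_⟩
  intro n₀ N _ _ V ε a q₀ m₀ ct cδ cr hVu hVP hε hVε ha0 ha hq0 hq hm₀ hct hcδ hcr hΘ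
  obtain ⟨useq, Eseq, hseq⟩ := hseqall n₀ N V ε a q₀ m₀ ct cδ cr hVu hVP hε hVε ha0 ha hq0 hq hm₀ hct hcδ hcr hΘ
  set T : Fin (d + 1) → ℕ := fine n₀ (fun _ : Fin (d + 1) => N) with hT
  -- numbers
  have hn1 : (1 : ℝ) ≤ n₀ := by exact_mod_cast Nat.one_le_iff_ne_zero.mpr (NeZero.ne n₀)
  have hm0 : 0 ≤ m₀ := by rw [hm₀]; positivity
  have hct0 : 0 ≤ ct := by rw [hct]; positivity
  have hcδ0 : 0 ≤ cδ := by rw [hcδ]; positivity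
  have hcr1 : 1 ≤ cr := by
    rw [hcr]
    have : 0 ≤ 8 * (ct + cδ) * cδ := by positivity
    nlinarith
  have hcr80 : cr * m₀ ≤ 1 / 80 := by
    have h1 : 0 ≤ 40 * ct + 40 * cδ + 8 * (ct + cδ) * (2 * cr + cδ) + 2 * (4 * ct + 128 * cr * (cδ + 1 / 2)) := by
      have : 0 ≤ cr := by linarith
      positivity
    nlinarith
  have hr4 : cr * (m₀ / n₀) ≤ 1 / 4 := by
    have : cr * (m₀ / n₀) ≤ cr * m₀ := mul_le_mul_of_nonneg_left (div_le_self hm0 hn1) (by linarith)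
    linarith
  -- the pointwise limit of the gauges
  have hcau : ∀ y : Site (d + 1), CauchySeq fun i => ((useq i y : (Matrix n n ℂ)ˣ) : Matrix n n ℂ) := fun y =>
    cauchySeq_of_le_geometric (1 / 2) (2 * ct * m₀) (by norm_num) fun i => by
      rw [dist_eq_norm, norm_sub_rev]; exact (hseq i).2.2.2.2.2.2.2.2.2.2.1 y
  choose ulim hul using fun y => cauchySeq_tendsto_of_complete (hcau y)
  have hmem : ∀ y : Site (d + 1), ulim y ∈ unitary (Matrix n n ℂ) := fun y =>
    isClosed_unitary.mem_of_tendsto (hul y) (Eventually.of_forall fun i => mem_unitaryUnits.mp ((hseq i).1 y))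
  let u : Site (d + 1) → (Matrix n n ℂ)ˣ := fun y => Unitary.toUnits ⟨ulim y, hmem y⟩
  have hval : ∀ y : Site (d + 1), ((u y : (Matrix n n ℂ)ˣ) : Matrix n n ℂ) = ulim y := fun y => rfl
  have huU : IsUnitarySite u := fun y => mem_unitaryUnits.mpr (by rw [hval]; exact hmem y)
  have huP : IsPeriodicSite u ((n₀ * N : ℕ) : ℤ) := by
    intro y ι
    have hfun : (fun k => ((useq k (y + ((n₀ * N : ℕ) : ℤ) • e ι) : (Matrix n n ℂ)ˣ) : Matrix n n ℂ)) = fun k => ((useq k y : (Matrix n n ℂ)ˣ) : Matrix n n ℂ) := by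
      funext k; rw [(hseq k).2.1 y ι]
    have h1 := hul (y + ((n₀ * N : ℕ) : ℤ) • e ι)
    rw [hfun] at h1
    exact Units.ext (by rw [hval, hval]; exact tendsto_nhds_unique h1 (hul y))
  -- convergence of the links and the radius in the limit
  have hV : ∀ (y : Site (d + 1)) (κ : Fin (d + 1)),
      Tendsto (fun i => ((gaugeAct (useq i) V y κ : (Matrix n n ℂ)ˣ) : Matrix n n ℂ)) atTop (𝓝 ((gaugeAct u V y κ : (Matrix n n ℂ)ˣ) : Matrix n n ℂ)) := by
    intro y κ
    have hform : ∀ (v : Site (d + 1) → (Matrix n n ℂ)ˣ), IsUnitarySite v →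
        ((gaugeAct v V y κ : (Matrix n n ℂ)ˣ) : Matrix n n ℂ) = (v y : Matrix n n ℂ) * (V y κ : Matrix n n ℂ) * star ((v (y + e κ) : (Matrix n n ℂ)ˣ) : Matrix n n ℂ) :=
      fun v hv => by simp only [gaugeAct, Units.val_mul, AveragingDeficitTransport.val_inv_eq_star_of_unitary (hv (y + e κ))]
    rw [hform u huU]
    simp only [hform (useq _) ((hseq _).1), hval]
    exact ((hul y).mul tendsto_const_nhds).mul (hul (y + e κ)).star
  have hr : ∀ (y : Site (d + 1)) (κ : Fin (d + 1)), ‖((gaugeAct u V y κ : (Matrix n n ℂ)ˣ) : Matrix n n ℂ) - 1‖ ≤ cr * (m₀ / n₀) := fun y κ =>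
    le_of_tendsto ((hV y κ).sub_const 1).norm (Eventually.of_forall fun i => (hseq i).2.2.2.2.2.2.2.1 y κ)
  -- the logarithms converge, and so do the `E_i`
  have hZlim : ∀ (y : Site (d + 1)) (κ : Fin (d + 1)),
      Tendsto (fun i => mlog ((gaugeAct (useq i) V y κ : (Matrix n n ℂ)ˣ) : Matrix n n ℂ)) atTop (𝓝 (mlog ((gaugeAct u V y κ : (Matrix n n ℂ)ˣ) : Matrix n n ℂ))) := by
    intro y κ
    rw [tendsto_iff_norm_sub_tendsto_zero]
    have h0 : Tendsto (fun i => 4 / 3 * ‖((gaugeAct (useq i) V y κ : (Matrix n n ℂ)ˣ) : Matrix n n ℂ) - gaugeAct u V y κ‖) atTop (𝓝 0) := by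
      have := (tendsto_iff_norm_sub_tendsto_zero.mp (hV y κ)).const_mul (4 / 3)
      simpa using this
    exact squeeze_zero (fun _ => norm_nonneg _)
      (fun i => norm_mlog_sub_mlog_le_four_thirds hr4 ((hseq i).2.2.2.2.2.2.2.1 y κ) (hr y κ)) h0
  have hElim : ∀ (y : Site (d + 1)) (κ : Fin (d + 1)), Tendsto (fun i => Eseq i y κ) atTop (𝓝 (mlog ((gaugeAct u V y κ : (Matrix n n ℂ)ˣ) : Matrix n n ℂ))) := by
    intro y κ
    have hN0 : Tendsto (fun i => mlog ((gaugeAct (useq i) V y κ : (Matrix n n ℂ)ˣ) : Matrix n n ℂ) - Eseq i y κ) atTop (𝓝 0) := by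
      have hgeom : Tendsto (fun i : ℕ => m₀ / n₀ * (1 / 2 : ℝ) ^ i) atTop (𝓝 0) := by
        have := (tendsto_pow_atTop_nhds_zero_of_lt_one (by norm_num : (0 : ℝ) ≤ 1 / 2) (by norm_num)).const_mul (m₀ / n₀)
        simpa using this
      exact squeeze_zero_norm (fun i => (hseq i).2.2.2.2.2.2.2.2.1 y κ) hgeom
    have h := (hZlim y κ).sub hN0
    simp only [sub_sub_cancel, sub_zero] at h
    exact h
  -- the torus restrictions of the entries converge
  have hRlim : ∀ j j' : n, Tendsto (fun i => fun p : Tor T × Fin (d + 1) => Eseq i (rep T p.1) p.2 j j') atTop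
      (𝓝 fun p : Tor T × Fin (d + 1) => mlog ((gaugeAct u V (rep T p.1) p.2 : (Matrix n n ℂ)ˣ) : Matrix n n ℂ) j j') := by
    intro j j'
    rw [tendsto_pi_nhds]
    intro p
    exact ((Continuous.matrix_elem continuous_id j j').tendsto _).comp (hElim (rep T p.1) p.2)
  have hmulVec : ∀ {ι : Type} [Fintype ι] (A : Matrix ι (Tor T × Fin (d + 1)) ℂ) (j j' : n),
      Tendsto (fun i => A *ᵥ fun p : Tor T × Fin (d + 1) => Eseq i (rep T p.1) p.2 j j') atTop
        (𝓝 (A *ᵥ fun p : Tor T × Fin (d + 1) => mlog ((gaugeAct u V (rep T p.1) p.2 : (Matrix n n ℂ)ˣ) : Matrix n n ℂ) j j')) := by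
    intro ι _ A j j'
    exact ((Matrix.mulVecLin A).continuous_of_finiteDimensional.tendsto _).comp (hRlim j j')
  refine ⟨u, huU, huP, fun y => ?_, hr, fun j j' => ?_, fun y κ => ?_, fun j j' t κ => ?_⟩
  · exact le_of_tendsto ((hul y).sub_const 1).norm (Eventually.of_forall fun i => (hseq i).2.2.2.2.2.2.2.2.2.1 y)
  · -- exactness passes to the limit
    have h := hmulVec ((1 - PcT n₀ (fun _ : Fin (d + 1) => N) (n₀ : ℂ)) * (GradOp T (n₀ : ℂ))ᴴ) j j'
    simp only [← Matrix.mulVec_mulVec] at h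
    have h0 : (fun i => (1 - PcT n₀ (fun _ : Fin (d + 1) => N) (n₀ : ℂ)) *ᵥ ((GradOp T (n₀ : ℂ))ᴴ *ᵥ fun p : Tor T × Fin (d + 1) => Eseq i (rep T p.1) p.2 j j'))
        = fun _ => 0 := by
      funext i; exact (hseq i).2.2.2.2.1 j j'
    rw [h0] at h
    exact (tendsto_nhds_unique tendsto_const_nhds h).symm
  · exact le_of_tendsto (hElim y κ).norm (Eventually.of_forall fun i => (hseq i).2.2.2.2.2.1 y κ)
  · have h := ((continuous_apply (t, κ)).tendsto _).comp (hmulVec (QvOp n₀ (fun _ : Fin (d + 1) => N)) j j')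
    exact le_of_tendsto h.norm (Eventually.of_forall fun i => (hseq i).2.2.2.2.2.2.1 j j' t κ)

end

end Summit.QuantumFields.BalabanUV.T4Continuum.NE7LandauNewtonLimit
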